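import Summits.ResolutionOfSingularities.ResolutionOfSingularities.Theorems.EquisingularLiftEquisingularLiftNatFirstOrderPoints
import Summits.ResolutionOfSingularities.ResolutionOfSingularities.Theorems.EquisingularLiftEquisingularLiftBlowupModelFirstOrderPoints
import Summits.ResolutionOfSingularities.ResolutionOfSingularities.Theorems.EquisingularLiftEquisingularLiftOrdinaryPointsJacobianTransport
import Literature.Algebra.Polynomial.JacobianCriterion
import HarnessLib

/-!
# [OURS · tools] THE FIRST-ORDER CRITERION UNDER INVERTIBLE LINEAR SUBSTITUTIONS (every field), and first-order points IN ANY LINEAR COORDINATES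
# (cruxes `Theses.EquisingularLift.EquisingularLiftNat` / `…NatThree` / `EquisingularLift`, stmt-ResolutionOfSingularities-20038 / -20148 / -15660)

[OURS · leafhand-res-equisingularlift-9 g0, 2026-08-31; cell `pub/decomp-res`] AI-produced, weaker than expert review; NOT a statement of any manuscript;
nothing here proves resolution of singularities in positive characteristic.  DEF-FREE helper; no `sorry`; standard axioms; ZERO named hypotheses.

The first-order criterion of ✓ `FirstOrderPoint.exists_strictTransform` (…NatFirstOrderStrictTransform),

  (FO) every prime of `K[y]` containing `Φ`, all `∂Φ/∂y_i` and `Ψ₁` contains all `y_i`,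

travels along invertible LINEAR substitutions `M` of the chart variables, AND along the change `(Φ, Ψ₁) ↦ (u·Φ(M), A·Φ(M) + w·Ψ₁(M))` (`u, w ≠ 0`, `A` arbitrary) that
a change of the dehomogenising hyperplane produces on the two leading forms of a chart (next file):

* ★ `FirstOrderPoint.firstOrder_of_linSubst` — EVERY FIELD, prime by prime: the old partials are recovered from the new ones through the chain rule
  `∂_iΦ = ∂_i(Φ(M)(M')) = Σ_k (∂_k Φ(M))(M')·∂_i M'_k` (✓ `Literature.Algebra.Polynomial.JacobianCriterion.pderiv_aeval`), so NO Jacobian matrix is inverted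
  and no algebraic closure is needed (contrast ✓ `MultiOrd.isNonsingularForm_aeval_of_linSubst`, closed points over `K̄`);
* `FirstOrderPoint.aeval_ne_zero_of_linSubst` — `Φ ≠ 0 ⇒ Φ(M) ≠ 0`;
* ★★ `FirstOrderPoint.elNatAt_of_linSubst_firstOrderPoints_of_jacobian` / `…_of_jacobian'` — EL♮ (`ELNatAt`) for every `(H, ι)` of the crux whose image has,
  IN SOME LINEAR COORDINATES `x' = τ(x)`, only first-order points at coordinate vertices as singular points (`K = K̄` of characteristic `p`, any dimension, any
  degree; the singular locus read in the new or in the ORIGINAL coordinates) — ✓ `FirstOrderPoint.elNatAt_firstOrderPoints_of_jacobian` for `σ_{τ'}F` carried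
  back along `α_τ ∈ PGL` (✓ `QuadricELNat.elNatAt_of_elNatAt_linSubst`, ✓ `MultiOrd.jacobian_of_linSubst`);
* ★★ `StrataSplit.blowupModel_of_range_eq_of_linSubst_firstOrderPoints_of_jacobian` / `…'` — the same in the currency of crux 15660 (regular blow-up model).

Honest label: closes no registered stub of 20038 / 20148 / 15660.

References: [Hartshorne1977, I Thm. 5.1, II Example 7.1.1, II Ex. 7.12]; [Humphreys1990, §3.10 (chain rule)]; [Matsumura1987, Thm. 14.2] — through the
cited tree files.
-/

set_option linter.dupNamespace false -- mandated namespace `Summit.<Summit>.<Problem>` of this single-conjunct summit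

noncomputable section

open CategoryTheory CategoryTheory.Limits AlgebraicGeometry TopologicalSpace
open MvPolynomial
open Literature.AlgebraicGeometry.Resolution
open Literature.AlgebraicGeometry.Motives Literature.AlgebraicGeometry.Motives.SmoothHypersurface
open Literature.AlgebraicGeometry.Motives.ProjectiveSpace

namespace Summit.ResolutionOfSingularities.ResolutionOfSingularities.Cruxes.EquisingularLiftNat.Sections

namespace FirstOrderPoint

variable (K : Type) [Field K] {n : ℕ}

/-! ## Mutually inverse substitutions -/

/-- `σ_M ∘ σ_{M'} = id` on polynomials when `M'_j(M) = y_j`. [folklore] -/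
theorem aeval_aeval_eq_self (M M' : Fin n → MvPolynomial (Fin n) K) (hMM' : ∀ j, aeval M (M' j) = X j) (q : MvPolynomial (Fin n) K) :
    aeval M (aeval M' q) = q := by
  have h1 : (aeval M).comp (aeval M') = AlgHom.id K (MvPolynomial (Fin n) K) :=
    MvPolynomial.algHom_ext fun i => by rw [AlgHom.comp_apply, aeval_X, hMM', AlgHom.id_apply]
  have h2 := congrArg (fun φ : MvPolynomial (Fin n) K →ₐ[K] MvPolynomial (Fin n) K => φ q) h1
  simpa using h2

/-- **`Φ ≠ 0 ⇒ Φ(M) ≠ 0`** for an invertible substitution. [folklore] -/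
theorem aeval_ne_zero_of_linSubst (M M' : Fin n → MvPolynomial (Fin n) K) (hM'M : ∀ j, aeval M' (M j) = X j)
    {Φ : MvPolynomial (Fin n) K} (hΦ : Φ ≠ 0) : aeval M Φ ≠ 0 := fun h => by
  have h1 := aeval_aeval_eq_self K M' M hM'M Φ
  rw [h, map_zero] at h1
  exact hΦ h1.symm

/-! ## ★ The first-order criterion under invertible linear substitutions -/

/-- ★ **THE FIRST-ORDER CRITERION TRAVELS ALONG INVERTIBLE LINEAR SUBSTITUTIONS — every field.**  `M, M'` mutually inverse substitutions of `K[y₁,…,y_n]`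
(`M'_j(M) = y_j`, `M_j(M') = y_j`) with `M'_j ∈ (y)` (no constant terms); `(Φ, Ψ₁)` satisfying (FO); `u, w ∈ K^×`, `A` arbitrary.  Then the pair
`(u·Φ(M), A·Φ(M) + w·Ψ₁(M))` satisfies (FO).  For a prime `P` containing `u·Φ(M)`, all `∂_i(u·Φ(M))` and `A·Φ(M) + w·Ψ₁(M)`: `Φ(M), ∂_kΦ(M), Ψ₁(M) ∈ P`;
the prime `Q = σ_M⁻¹P` contains `Φ`, `Ψ₁` and — chain rule `∂_iΦ = Σ_k (∂_kΦ(M))(M')·∂_iM'_k`, then `σ_M` — all `∂_iΦ`; (FO) gives `y_i ∈ Q`, i.e. `M_i ∈ P`,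
and `y_j = M'_j(M) ∈ (M_1,…,M_n) ⊆ P`. [cite: Humphreys1990, §3.10] [cite: Hartshorne1977, I Thm. 5.1] -/
theorem firstOrder_of_linSubst (M M' : Fin n → MvPolynomial (Fin n) K)
    (hMM' : ∀ j, aeval M (M' j) = X j) (hM'M : ∀ j, aeval M' (M j) = X j)
    (hM'0 : ∀ j, M' j ∈ Ideal.span (Set.range (X : Fin n → MvPolynomial (Fin n) K)))
    {Φ Ψ₁ : MvPolynomial (Fin n) K}
    (hfo : ∀ P : Ideal (MvPolynomial (Fin n) K), P.IsPrime → Φ ∈ P → (∀ i, pderiv i Φ ∈ P) → Ψ₁ ∈ P →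
      ∀ i, (X i : MvPolynomial (Fin n) K) ∈ P)
    {u w : K} (hu : u ≠ 0) (hw : w ≠ 0) (A : MvPolynomial (Fin n) K)
    (P : Ideal (MvPolynomial (Fin n) K)) (hP : P.IsPrime) (h1 : C u * aeval M Φ ∈ P) (h2 : ∀ i, pderiv i (C u * aeval M Φ) ∈ P)
    (h3 : A * aeval M Φ + C w * aeval M Ψ₁ ∈ P) (i : Fin n) : (X i : MvPolynomial (Fin n) K) ∈ P := by
  classical
  have huU : IsUnit (C u : MvPolynomial (Fin n) K) := (isUnit_iff_ne_zero.mpr hu).map C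
  have hwU : IsUnit (C w : MvPolynomial (Fin n) K) := (isUnit_iff_ne_zero.mpr hw).map C
  have hΦM : aeval M Φ ∈ P := (Ideal.unit_mul_mem_iff_mem P huU).mp h1
  have hdM : ∀ k, pderiv k (aeval M Φ) ∈ P := fun k => by
    have h := h2 k
    rw [pderiv_C_mul] at h
    exact (Ideal.unit_mul_mem_iff_mem P huU).mp h
  have hΨM : aeval M Ψ₁ ∈ P := by
    have h : C w * aeval M Ψ₁ = (A * aeval M Φ + C w * aeval M Ψ₁) - A * aeval M Φ := by ring
    exact (Ideal.unit_mul_mem_iff_mem P hwU).mp (h ▸ P.sub_mem h3 (P.mul_mem_left _ hΦM))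
  -- pull back along `σ_M`
  set Q : Ideal (MvPolynomial (Fin n) K) := P.comap (aeval M).toRingHom with hQ
  haveI : Q.IsPrime := Ideal.comap_isPrime _ P
  have hmem : ∀ q : MvPolynomial (Fin n) K, q ∈ Q ↔ aeval M q ∈ P := fun q => by rw [hQ, Ideal.mem_comap]; rfl
  have hdQ : ∀ i, pderiv i Φ ∈ Q := fun i => by
    rw [hmem]
    have hchain : pderiv i Φ = ∑ k, aeval M' (pderiv k (aeval M Φ)) * pderiv i (M' k) := by
      conv_lhs => rw [← aeval_aeval_eq_self K M' M hM'M Φ]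
      exact Literature.Algebra.Polynomial.JacobianCriterion.pderiv_aeval M' (aeval M Φ) i
    rw [hchain, map_sum]
    refine P.sum_mem fun k _ => ?_
    rw [map_mul, aeval_aeval_eq_self K M M' hMM']
    exact P.mul_mem_right _ (hdM k)
  have hXQ : ∀ i, (X i : MvPolynomial (Fin n) K) ∈ Q := hfo Q inferInstance ((hmem Φ).mpr hΦM) hdQ ((hmem Ψ₁).mpr hΨM)
  have hMP : ∀ i, M i ∈ P := fun i => by
    have h := (hmem (X i)).mp (hXQ i)
    rwa [aeval_X] at h
  -- `y_i = M'_i(M) ∈ (M_1, …, M_n) ⊆ P`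
  have hle : Ideal.map (aeval M).toRingHom (Ideal.span (Set.range (X : Fin n → MvPolynomial (Fin n) K))) ≤ P := by
    rw [Ideal.map_span, Ideal.span_le]
    rintro _ ⟨_, ⟨k, rfl⟩, rfl⟩
    simp only [AlgHom.toRingHom_eq_coe, RingHom.coe_coe, aeval_X, SetLike.mem_coe]
    exact hMP k
  rw [← hMM' i]
  exact hle (Ideal.mem_map_of_mem (aeval M).toRingHom (hM'0 i))

end FirstOrderPoint

/-! ## ★★ First-order points in any linear coordinates: EL♮ -/

namespace FirstOrderPoint

open Summit.ResolutionOfSingularities.ResolutionOfSingularities.Cruxes.EquisingularLift.StrataSplit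

/-- ★★ **EL♮ (`ELNatAt`) for every `(H, ι)` of the crux whose image has, IN SOME LINEAR COORDINATES, only FIRST-ORDER points at coordinate vertices as singular
points** — `K = K̄` of characteristic `p`, any dimension, any degree: `range ι = V₊(F)`, `F` a prime form, `τ, τ'` mutually inverse linear substitutions,
`G := σ_{τ'} F` satisfying (fo) at the marked vertices `c ∈ S` and (jac) «its singular points are among the marked vertices»;
✓ `elNatAt_firstOrderPoints_of_jacobian` for `V₊(G)` (`G` is a prime form, ✓ `prime_aeval_of_linSubst`) travels back along `α_τ ∈ PGL_{m+3}(K)`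
(✓ `QuadricELNat.elNatAt_of_elNatAt_linSubst`).  In particular every integral hypersurface whose singular points are `≤ m + 3` first-order points in linearly
general position, once the first-order data are written in the normalised coordinates. [OURS] [cite: Hartshorne1977, I Thm. 5.1, II Example 7.1.1] -/
theorem elNatAt_of_linSubst_firstOrderPoints_of_jacobian {K : Type} [Field K] (p : ℕ) (hp : p.Prime) [CharP K p] [IsAlgClosed K] {m : ℕ}
    {H : Scheme.{0}} (ι : H ⟶ (projectiveSpace (m + 1 + 1) K).left) [IsClosedImmersion ι]
    (F : MvPolynomial (Fin (m + 1 + 1 + 1)) K) {d : ℕ} (hF : F.IsHomogeneous d) (hFp : Prime F)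
    (hrange : letI := MvPolynomial.gradedAlgebra (σ := Fin (m + 1 + 1 + 1)) (R := K)
      Set.range ι = {x : Proj (homogeneousSubmodule (Fin (m + 1 + 1 + 1)) K) | F ∈ x.asHomogeneousIdeal})
    (τ τ' : Fin (m + 1 + 1 + 1) → MvPolynomial (Fin (m + 1 + 1 + 1)) K) (hτ : ∀ i, (τ i).IsHomogeneous 1) (hτ' : ∀ i, (τ' i).IsHomogeneous 1)
    (hinv : ∀ i, aeval τ (τ' i) = X i) (hinv' : ∀ i, aeval τ' (τ i) = X i)
    (S : List (Fin (m + 2 + 1))) (hS : S.Nodup)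
    (hfo : ∀ c ∈ S, ∃ (μ : ℕ) (Φ Ψ₁ Ψ' : MvPolynomial (Fin (m + 2)) K), 1 ≤ μ ∧ Φ.IsHomogeneous μ ∧ Φ ≠ 0 ∧ Ψ₁.IsHomogeneous (μ + 1) ∧
      Ψ' ∈ Ideal.span (Set.range (X : Fin (m + 2) → MvPolynomial (Fin (m + 2)) K)) ^ (μ + 2) ∧
      ProjectiveSpace.dehomogenize K c (aeval τ' F) = Φ + (Ψ₁ + Ψ') ∧
      ∀ b : Fin (m + 2) → K, aeval b Φ = 0 → (∀ i, aeval b (pderiv i Φ) = 0) → aeval b Ψ₁ = 0 → b = 0)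
    (hjac : ∀ a : Fin (m + 2 + 1) → K, a ≠ 0 → eval a (aeval τ' F) = 0 → (∀ i, eval a (pderiv i (aeval τ' F)) = 0) →
      ∃ c ∈ S, ∀ i, i ≠ c → a i = 0) :
    Theorems.EquisingularLift.ELNatAt p K (m + 1 + 1) H ι := by
  have hG : (aeval τ' F).IsHomogeneous d := by
    have h := hF.aeval τ' hτ'
    rwa [one_mul] at h
  exact QuadricELNat.elNatAt_of_elNatAt_linSubst τ τ' hτ hτ' hinv hinv' p ι F hrange
    (elNatAt_firstOrderPoints_of_jacobian p hp K (aeval τ' F) hG (prime_aeval_of_linSubst τ τ' hinv hinv' hFp) S hS hjac hfo)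

/-- ★★ **The same with the singular locus read in the ORIGINAL coordinates**: (jac) every `b ≠ 0` with `F(b) = 0`, `∇F(b) = 0` is one of the marked points
`{τ_i = 0 (i ≠ c)}`, `c ∈ S` (✓ `MultiOrd.jacobian_of_linSubst`). [OURS] [cite: Hartshorne1977, I Thm. 5.1, II Example 7.1.1] -/
theorem elNatAt_of_linSubst_firstOrderPoints_of_jacobian' {K : Type} [Field K] (p : ℕ) (hp : p.Prime) [CharP K p] [IsAlgClosed K] {m : ℕ}
    {H : Scheme.{0}} (ι : H ⟶ (projectiveSpace (m + 1 + 1) K).left) [IsClosedImmersion ι]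
    (F : MvPolynomial (Fin (m + 1 + 1 + 1)) K) {d : ℕ} (hF : F.IsHomogeneous d) (hFp : Prime F)
    (hrange : letI := MvPolynomial.gradedAlgebra (σ := Fin (m + 1 + 1 + 1)) (R := K)
      Set.range ι = {x : Proj (homogeneousSubmodule (Fin (m + 1 + 1 + 1)) K) | F ∈ x.asHomogeneousIdeal})
    (τ τ' : Fin (m + 1 + 1 + 1) → MvPolynomial (Fin (m + 1 + 1 + 1)) K) (hτ : ∀ i, (τ i).IsHomogeneous 1) (hτ' : ∀ i, (τ' i).IsHomogeneous 1)
    (hinv : ∀ i, aeval τ (τ' i) = X i) (hinv' : ∀ i, aeval τ' (τ i) = X i)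
    (S : List (Fin (m + 2 + 1))) (hS : S.Nodup)
    (hfo : ∀ c ∈ S, ∃ (μ : ℕ) (Φ Ψ₁ Ψ' : MvPolynomial (Fin (m + 2)) K), 1 ≤ μ ∧ Φ.IsHomogeneous μ ∧ Φ ≠ 0 ∧ Ψ₁.IsHomogeneous (μ + 1) ∧
      Ψ' ∈ Ideal.span (Set.range (X : Fin (m + 2) → MvPolynomial (Fin (m + 2)) K)) ^ (μ + 2) ∧
      ProjectiveSpace.dehomogenize K c (aeval τ' F) = Φ + (Ψ₁ + Ψ') ∧
      ∀ b : Fin (m + 2) → K, aeval b Φ = 0 → (∀ i, aeval b (pderiv i Φ) = 0) → aeval b Ψ₁ = 0 → b = 0)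
    (hjacF : ∀ b : Fin (m + 2 + 1) → K, b ≠ 0 → eval b F = 0 → (∀ j, eval b (pderiv j F) = 0) →
      ∃ c ∈ S, ∀ i, i ≠ c → eval b (τ i) = 0) :
    Theorems.EquisingularLift.ELNatAt p K (m + 1 + 1) H ι :=
  elNatAt_of_linSubst_firstOrderPoints_of_jacobian p hp ι F hF hFp hrange τ τ' hτ hτ' hinv hinv' S hS hfo
    (MultiOrd.jacobian_of_linSubst τ τ' hτ hinv hinv' S F hjacF)

end FirstOrderPoint

end Summit.ResolutionOfSingularities.ResolutionOfSingularities.Cruxes.EquisingularLiftNat.Sections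

/-! ## ★★ First-order points in any linear coordinates: regular blow-up models (crux 15660) -/

namespace Summit.ResolutionOfSingularities.ResolutionOfSingularities.Cruxes.EquisingularLift.StrataSplit

open Summit.ResolutionOfSingularities.ResolutionOfSingularities.Cruxes.EquisingularLiftNat.Sections
open Summit.ResolutionOfSingularities.ResolutionOfSingularities.Cruxes.EquisingularLiftNat

/-- ★★ **Every `(H, ι)` of crux `EquisingularLift` whose image has, IN SOME LINEAR COORDINATES, only FIRST-ORDER points at coordinate vertices as singular
points has a regular blow-up model** — `K = K̄`, any characteristic, any dimension, any degree (✓ `blowupModel_of_range_eq_firstOrderPoints_of_jacobian` for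
`G = σ_{τ'}F`, ✓ `prime_aeval_of_linSubst`, ✓ `exists_closedImmersion_range_eq_of_linSubst`). [cite: Hartshorne1977, II Example 7.1.1, II Ex. 7.12] -/
theorem blowupModel_of_range_eq_of_linSubst_firstOrderPoints_of_jacobian {K : Type} [Field K] [IsAlgClosed K] {m : ℕ} {H : Scheme.{0}}
    (ι : H ⟶ (projectiveSpace (m + 1 + 1) K).left) [IsClosedImmersion ι] [IsIntegral H]
    (F : MvPolynomial (Fin (m + 1 + 1 + 1)) K) {d : ℕ} (hF : F.IsHomogeneous d) (hFp : Prime F)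
    (hrange : letI := MvPolynomial.gradedAlgebra (σ := Fin (m + 1 + 1 + 1)) (R := K)
      Set.range ι = {x : Proj (homogeneousSubmodule (Fin (m + 1 + 1 + 1)) K) | F ∈ x.asHomogeneousIdeal})
    (τ τ' : Fin (m + 1 + 1 + 1) → MvPolynomial (Fin (m + 1 + 1 + 1)) K) (hτ : ∀ i, (τ i).IsHomogeneous 1) (hτ' : ∀ i, (τ' i).IsHomogeneous 1)
    (hinv : ∀ i, aeval τ (τ' i) = X i) (hinv' : ∀ i, aeval τ' (τ i) = X i)
    (S : List (Fin (m + 2 + 1))) (hS : S.Nodup)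
    (hfo : ∀ c ∈ S, ∃ (μ : ℕ) (Φ Ψ₁ Ψ' : MvPolynomial (Fin (m + 2)) K), 1 ≤ μ ∧ Φ.IsHomogeneous μ ∧ Φ ≠ 0 ∧ Ψ₁.IsHomogeneous (μ + 1) ∧
      Ψ' ∈ Ideal.span (Set.range (X : Fin (m + 2) → MvPolynomial (Fin (m + 2)) K)) ^ (μ + 2) ∧
      ProjectiveSpace.dehomogenize K c (aeval τ' F) = Φ + (Ψ₁ + Ψ') ∧
      ∀ b : Fin (m + 2) → K, aeval b Φ = 0 → (∀ i, aeval b (pderiv i Φ) = 0) → aeval b Ψ₁ = 0 → b = 0)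
    (hjac : ∀ a : Fin (m + 2 + 1) → K, a ≠ 0 → eval a (aeval τ' F) = 0 → (∀ i, eval a (pderiv i (aeval τ' F)) = 0) →
      ∃ c ∈ S, ∀ i, i ≠ c → a i = 0) :
    ∃ 𝔞 : H.IdealSheafData, 𝔞 ≠ ⊥ ∧ ∀ (Z : Scheme.{0}) (π : Z ⟶ H), IsBlowup π 𝔞 → Scheme.IsRegular Z := by
  letI := MvPolynomial.gradedAlgebra (σ := Fin (m + 1 + 1 + 1)) (R := K)
  obtain ⟨ι₁, hι₁, hrange₁⟩ := exists_closedImmersion_range_eq_of_linSubst τ τ' hτ hτ' hinv hinv' ι F hrange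
  haveI := hι₁
  have hG : (aeval τ' F).IsHomogeneous d := by
    have h := hF.aeval τ' hτ'
    rwa [one_mul] at h
  exact blowupModel_of_range_eq_firstOrderPoints_of_jacobian ι₁ (aeval τ' F) hG (prime_aeval_of_linSubst τ τ' hinv hinv' hFp) S hS hjac hfo hrange₁

/-- ★★ **The same with the singular locus read in the ORIGINAL coordinates** (✓ `MultiOrd.jacobian_of_linSubst`).
[cite: Hartshorne1977, II Example 7.1.1, II Ex. 7.12] -/
theorem blowupModel_of_range_eq_of_linSubst_firstOrderPoints_of_jacobian' {K : Type} [Field K] [IsAlgClosed K] {m : ℕ} {H : Scheme.{0}}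
    (ι : H ⟶ (projectiveSpace (m + 1 + 1) K).left) [IsClosedImmersion ι] [IsIntegral H]
    (F : MvPolynomial (Fin (m + 1 + 1 + 1)) K) {d : ℕ} (hF : F.IsHomogeneous d) (hFp : Prime F)
    (hrange : letI := MvPolynomial.gradedAlgebra (σ := Fin (m + 1 + 1 + 1)) (R := K)
      Set.range ι = {x : Proj (homogeneousSubmodule (Fin (m + 1 + 1 + 1)) K) | F ∈ x.asHomogeneousIdeal})
    (τ τ' : Fin (m + 1 + 1 + 1) → MvPolynomial (Fin (m + 1 + 1 + 1)) K) (hτ : ∀ i, (τ i).IsHomogeneous 1) (hτ' : ∀ i, (τ' i).IsHomogeneous 1)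
    (hinv : ∀ i, aeval τ (τ' i) = X i) (hinv' : ∀ i, aeval τ' (τ i) = X i)
    (S : List (Fin (m + 2 + 1))) (hS : S.Nodup)
    (hfo : ∀ c ∈ S, ∃ (μ : ℕ) (Φ Ψ₁ Ψ' : MvPolynomial (Fin (m + 2)) K), 1 ≤ μ ∧ Φ.IsHomogeneous μ ∧ Φ ≠ 0 ∧ Ψ₁.IsHomogeneous (μ + 1) ∧
      Ψ' ∈ Ideal.span (Set.range (X : Fin (m + 2) → MvPolynomial (Fin (m + 2)) K)) ^ (μ + 2) ∧
      ProjectiveSpace.dehomogenize K c (aeval τ' F) = Φ + (Ψ₁ + Ψ') ∧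
      ∀ b : Fin (m + 2) → K, aeval b Φ = 0 → (∀ i, aeval b (pderiv i Φ) = 0) → aeval b Ψ₁ = 0 → b = 0)
    (hjacF : ∀ b : Fin (m + 2 + 1) → K, b ≠ 0 → eval b F = 0 → (∀ j, eval b (pderiv j F) = 0) →
      ∃ c ∈ S, ∀ i, i ≠ c → eval b (τ i) = 0) :
    ∃ 𝔞 : H.IdealSheafData, 𝔞 ≠ ⊥ ∧ ∀ (Z : Scheme.{0}) (π : Z ⟶ H), IsBlowup π 𝔞 → Scheme.IsRegular Z :=
  blowupModel_of_range_eq_of_linSubst_firstOrderPoints_of_jacobian ι F hF hFp hrange τ τ' hτ hτ' hinv hinv' S hS hfo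
    (MultiOrd.jacobian_of_linSubst τ τ' hτ hinv hinv' S F hjacF)

end Summit.ResolutionOfSingularities.ResolutionOfSingularities.Cruxes.EquisingularLift.StrataSplit

end
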